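import Mathlib
import Summits.Schanuel.Schanuel.Theses.RootDecomp1B
import Summits.Schanuel.Schanuel.Theorems.RootDecomp1CAxisReduction

/-!
# RootDecomp1B — the support `ConjStableReduction` (stmt-Schanuel-24625)

`ConjStableReduction`: every counterexample to Schanuel's conjecture yields a CONJUGATION-STABLE
counterexample. Proof (census seat, as noted in the critic-cleared lens-6 extract
`HOME/decomp-schanuel-lens-6/ConjugationSymmetrisation.lean`, header «Corollary for the sibling node
PolarSymmetrisation»): by the landed σ-symmetrisation
`RootDecomp1CAxisReduction.schanuel_of_axisSchanuel : AxisSchanuel → Schanuel`, a counterexample `z` forces an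
AXIS counterexample `w` (every `w j` real or purely imaginary), and an axis tuple is conjugation-stable since
`conj (w j) = ± w j`. 0 sorry.
-/

set_option linter.dupNamespace false

namespace Summit.Schanuel.Schanuel.Theorems.RootDecomp1BConjStableReduction

open Summit.Schanuel.Schanuel.Theses.RootDecomp1B

/-- An axis number (real or purely imaginary) has its complex conjugate in its own `ℚ`-span:
`conj w = w` or `conj w = -w`. -/
theorem conj_mem_span_of_axis {d : ℕ} (w : Fin d → ℂ) (haxis : ∀ j, (w j).im = 0 ∨ (w j).re = 0)
    (j : Fin d) : (starRingEnd ℂ) (w j) ∈ Submodule.span ℚ (Set.range w) := by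
  have hmem : w j ∈ Submodule.span ℚ (Set.range w) := Submodule.subset_span ⟨j, rfl⟩
  rcases haxis j with h | h
  · have : (starRingEnd ℂ) (w j) = w j := Complex.conj_eq_iff_im.mpr h
    rw [this]
    exact hmem
  · have : (starRingEnd ℂ) (w j) = -w j := by
      apply Complex.ext
      · simp [Complex.conj_re, h]
      · simp [Complex.conj_im]
    rw [this]
    exact Submodule.neg_mem _ hmem

/-- Item stmt-Schanuel-24625 (`ConjStableReduction`, support r9 of route-Schanuel-RootDecomp1B): every
counterexample to Schanuel yields a conjugation-stable counterexample — via the axis reduction of route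
RootDecomp1C (contrapositive of `schanuel_of_axisSchanuel`). -/
theorem conjStableReduction_holds : ConjStableReduction := by
  intro n z hz hlt
  by_contra hno
  push Not at hno
  have hA : Summit.Schanuel.Schanuel.Theses.RootDecomp1C.AxisSchanuel := by
    intro d w haxis hw
    exact hno d w hw (conj_mem_span_of_axis w haxis)
  have hS := Summit.Schanuel.Schanuel.Theorems.RootDecomp1CAxisReduction.schanuel_of_axisSchanuel hA
  exact absurd (hS n z hz) (not_le.mpr hlt)

end Summit.Schanuel.Schanuel.Theorems.RootDecomp1BConjStableReduction
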